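import Summits.BirchSwinnertonDyer.BirchSwinnertonDyer.Theses.TangentCone
import Summits.BirchSwinnertonDyer.BirchSwinnertonDyer.Theses.PAdicOrderV2
import Summits.BirchSwinnertonDyer.BirchSwinnertonDyer.Theorems.PAdicOrderV2PadicBSDrankOrderEqCorankOdd
import Literature.NumberTheory.EllipticCurves.CyclotomicIwasawaMainTheoremIrreducible
import Literature.NumberTheory.EllipticCurves.CMTorsionIrreducibleOrdinaryProofs
import Literature.NumberTheory.EllipticCurves.IwasawaOrderKernelRankProofs
import Literature.NumberTheory.EllipticCurves.IwasawaLeadingTerm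
import Literature.NumberTheory.EllipticCurves.SelmerCorankControlRatOrdinaryProofs
import Literature.NumberTheory.EllipticCurves.KatoRankBound
import Literature.NumberTheory.EllipticCurves.SelmerCorankControl
import HarnessLib

/-!
# Crux `SelmerRankCM` (stmt-BirchSwinnertonDyer-18086), line `rubin-squeeze` — stub
# `stub_orderLeCorankCM` (LB-ALGEBRAIC-CM, `ord_{T=0} L_p(E,T) ≤ corank_{ℤ_p} Sel_{p^∞}(E/ℚ)` for CM
# curves): its EXACT open kernel, and the stub from the route items of `PAdicOrderV2`

Helper file (`--supports stmt-BirchSwinnertonDyer-18086`; it does NOT close the stub). The registered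
stub of `Cruxes/SelmerRankCM/Lines/rubin_squeeze.lean`,

  `∀ W elliptic, globally minimal, p prime, 5 ≤ p → good at p → p ∤ a_p → W.HasCM → 3 ≤ r_an →
     ∀ f newform of W, ord_{T=0} L_p(f, α_p, T) ≤ corank_{ℤ_p} Sel_{p^∞}(E/ℚ)`,

is an open problem (Greenberg, LNM 1716, §1 Conj. 1.12 for CM curves from corank `2` on). This
file kernel-checks what it IS, modulo theorems in print:

* `cm_order_le_selmerCorank_iff_semisimple` — POINTWISE, under the one named Literature fact
  `burungale_castella_skinner_charIdeal_eq_padicLFunction` (Mazur's main conjecture in `Λ ⊗ ℚ_p` for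
  `p ≥ 5` good ordinary with `E[p]` irreducible: Burungale–Castella–Skinner 2025, Thm. 1.1.2 (a); for
  a CM curve at a split prime this is Rubin's theorem, Invent. Math. 103 (1991), Thm. 4.1, and the
  hypothesis (irr_ℚ) is a tree THEOREM for CM curves at good ordinary `p ≥ 5`,
  `WeierstrassCurve.hasIrreducibleModPGaloisRep_of_hasCM_of_five_le`, Serre 1972 §4.5): for a CM
  curve `E/ℚ`, a good ordinary `p ≥ 5`, the cyclotomic datum `(κ, γ)` matching the variable `T`,
  ANY dual datum `D` (`X = D.X`) and the newform `f` of `E`,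
  `ord_T L_p ≤ corank Sel_{p^∞}(E/ℚ) ↔ ord_T L_p = corank ↔ ker (T ⊗ 1)² = ker (T ⊗ 1)` on
  `ℚ_p ⊗_{ℤ_p} X` — `T`-semisimplicity at `T = 0` (Greenberg's Conj. 1.12 at `T`). All other
  inputs are PROVED tree theorems: Mazur control in corank form
  (`Greenberg1999_coinvariantsRank_eq_selmerCorank_rat_holds`), finite generation of `X`
  (`SelmerDualData.module_finite_of_isCyclotomic`), the structure-theorem dichotomy
  (`IwasawaAlgebra.order_charGenerator_eq_coinvariantsRank_iff`, `selmerCorank_le_order_charGenerator`).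
* `orderLeCorankCM_iff_semisimpleCM` — GLOBALLY, under that fact and modularity
  (`exists_isNewformOf`, for CM curves Deuring–Hecke–Shimura): the stub statement is EQUIVALENT to
  Greenberg's Conj. 1.12 at `T` for CM curves of analytic rank `≥ 3` at good ordinary `p ≥ 5`
  (cyclotomic datum matching the variable, any dual datum) — the CM / `r_an ≥ 3` column of the
  route item `PAdicOrderV2.PAdicOrderSemisimpleR3` (stmt-0509) in its rational spelling.
* `orderLeCorankCM_of_bcs_of_semisimple` — the stub from the named fact and stmt-0509 by name
  (integral spelling, bridged by the landed `stub_ker_mulTRat_sq_eq`).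
* `orderLeCorankCM_of_mainConjecture_of_semisimple` — the stub from the two route items
  `PAdicOrderMainConjectureR7` (stmt-15426) and `PAdicOrderSemisimpleR3` (stmt-0509) by name, via the
  landed `stub_padicBSDrank_orderEqCorankOdd` with its control hypothesis discharged by the tree
  theorem `Greenberg1999_coinvariantsRank_eq_selmerCorank_rat_holds`.

So inside the fleet the stub costs exactly stmt-0509 restricted to CM curves (given the printed
main conjecture), or stmt-0490 (`PAdicOrderPadicBSDrankR2`, via the line's own
`orderLeCorankCM_of_padicBSDrank`). References: R. Greenberg, LNM 1716 (1999), §1 Conj. 1.12 and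
p. 65, Thm. 1.2; A. Burungale, F. Castella, C. Skinner, IMRN 2025 (arXiv:2405.00270v2), Thm. 1.1.2 (a);
K. Rubin, Invent. Math. 103 (1991), Thm. 4.1; J.-P. Serre, Invent. Math. 15 (1972), §4.5.
-/

-- D-0017: single-problem summit, so `Summit.BirchSwinnertonDyer.BirchSwinnertonDyer.…` repeats a
-- namespace BY DESIGN.
set_option linter.dupNamespace false

namespace Summit.BirchSwinnertonDyer.BirchSwinnertonDyer.Theorems

open scoped TensorProduct
open Literature.NumberTheory.EllipticCurves
open Literature.NumberTheory.EllipticCurves.ModularForms (IsNewformOf exists_isNewformOf)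
open Literature.NumberTheory.EllipticCurves.IwasawaAlgebra (mulTRat coinvariantsRank)
open Summit.BirchSwinnertonDyer.BirchSwinnertonDyer.Theses.PAdicOrderV2

/-! ### Pointwise: under the printed main conjecture, the stub's inequality at `(E, p)` is
`T`-semisimplicity of `X(E/ℚ_∞) ⊗ ℚ_p` at `T = 0` -/

section Pointwise

/-- **Main conjecture for a CM curve at a good ordinary `p ≥ 5`, order form.** From the named fact
`burungale_castella_skinner_charIdeal_eq_padicLFunction` (B–C–S 2025 Thm. 1.1.2 (a); for CM curves
Rubin 1991 Thm. 4.1), whose hypothesis (irr_ℚ) is the tree theorem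
`WeierstrassCurve.hasIrreducibleModPGaloisRep_of_hasCM_of_five_le` (Serre 1972 §4.5: the image
normalises a Cartan subgroup and the ordinary `p` does not divide the CM discriminant): `X = D.X` is
`Λ`-torsion and `char_Λ X = (g)` with `ord_{T=0} L_p(f, α_p, T) = ord_T g` (`ι g = p^k · L_p`, `p^k` a
unit of `ℚ_p`, `ι : Λ ↪ ℚ_p⟦T⟧` order-preserving, `bk_order_map_of_injective`).
[cite: BurungaleCastellaSkinner2025, Thm. 1.1.2 (a) (p. 2 of arXiv:2405.00270v2)]
[cite: Serre1972, §4.5 and §1.11] -/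
theorem cm_isTorsion_and_exists_charGenerator_order_eq
    (hBCS : burungale_castella_skinner_charIdeal_eq_padicLFunction)
    (W : WeierstrassCurve ℚ) [W.IsElliptic] [W.IsGloballyMinimal] (p : ℕ) [Fact p.Prime]
    (h5 : 5 ≤ p) (hgood : W.HasGoodReductionAtPrime p) (hord : ¬ (p : ℤ) ∣ W.frobeniusTrace p)
    (hCM : W.HasCM) {κ : ZpExtension ℚ p} {γ : Field.absoluteGaloisGroup ℚ}
    (hκ : κ.IsCyclotomic) (hγ : κ.IsTopGenerator γ) (hγ' : IsCyclotomicVariable p γ)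
    (D : W.SelmerDualData κ γ) {N : ℕ} [NeZero N] (f : CuspForm (CongruenceSubgroup.Gamma0 N) 2)
    (hf : IsNewformOf W f) :
    D.IsTorsion ∧ ∃ g : IwasawaAlgebra p, D.charIdeal = Ideal.span {g} ∧
      (padicLFunction f (unitRoot W p : ℚ_[p])).order = g.order := by
  obtain ⟨htors, g, k, hg, hι⟩ := hBCS W p κ γ f h5 hgood hord
    (W.hasIrreducibleModPGaloisRep_of_hasCM_of_five_le hCM p h5 hgood hord) hκ hγ hγ' hf D
  refine ⟨htors, g, hg, ?_⟩
  -- `ord_T ι g = ord_T g`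
  have h2 : (iwasawaToPowerSeries p g).order = g.order :=
    bk_order_map_of_injective (algebraMap ℤ_[p] ℚ_[p]) (IsFractionRing.injective ℤ_[p] ℚ_[p]) g
  -- `ord_T (p^k · L_p) = ord_T L_p`
  have hpk : IsUnit (PowerSeries.C ((p : ℚ_[p]) ^ k)) := by
    refine IsUnit.map PowerSeries.C (IsUnit.mk0 _ (zpow_ne_zero k ?_))
    exact_mod_cast (Fact.out : p.Prime).ne_zero
  rw [← h2, hι, PowerSeries.order_mul, PowerSeries.order_zero_of_unit hpk, zero_add]

/-- **`ord_T L_p = corank ↔ T`-semisimplicity, for a CM curve.** Under the named fact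
`burungale_castella_skinner_charIdeal_eq_padicLFunction`: for `E/ℚ` with CM (globally minimal `W`),
`p ≥ 5` good ordinary, the cyclotomic `κ` with topological generator `γ` matching the variable, any
dual datum `D` and the newform `f` of `E`,
`ord_{T=0} L_p(f, α_p, T) = corank_{ℤ_p} Sel_{p^∞}(E/ℚ) ↔ ker (T ⊗ 1)² = ker (T ⊗ 1)` on
`ℚ_p ⊗_{ℤ_p} X`. Proof: `ord_T L_p = ord_T g` (`cm_isTorsion_and_exists_charGenerator_order_eq`),
`corank = rank_{ℤ_p} X/TX` (Mazur control, tree theorem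
`Greenberg1999_coinvariantsRank_eq_selmerCorank_rat_holds`), and `ord_T g = rank_{ℤ_p} X/TX ↔
ker T² = ker T` for the finitely generated (`SelmerDualData.module_finite_of_isCyclotomic`) torsion
`X` (`IwasawaAlgebra.order_charGenerator_eq_coinvariantsRank_iff`, Greenberg LNM 1716 §1 p. 65).
[cite: GreenbergLNM1716, §1 Conj. 1.12 and p. 65, Thm. 1.2] -/
theorem cm_order_eq_selmerCorank_iff_semisimple
    (hBCS : burungale_castella_skinner_charIdeal_eq_padicLFunction)
    (W : WeierstrassCurve ℚ) [W.IsElliptic] [W.IsGloballyMinimal] (p : ℕ) [Fact p.Prime]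
    (h5 : 5 ≤ p) (hgood : W.HasGoodReductionAtPrime p) (hord : ¬ (p : ℤ) ∣ W.frobeniusTrace p)
    (hCM : W.HasCM) {κ : ZpExtension ℚ p} {γ : Field.absoluteGaloisGroup ℚ}
    (hκ : κ.IsCyclotomic) (hγ : κ.IsTopGenerator γ) (hγ' : IsCyclotomicVariable p γ)
    (D : W.SelmerDualData κ γ) {N : ℕ} [NeZero N] (f : CuspForm (CongruenceSubgroup.Gamma0 N) 2)
    (hf : IsNewformOf W f) :
    (padicLFunction f (unitRoot W p : ℚ_[p])).order = W.selmerCorank p ↔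
      LinearMap.ker (mulTRat p D.X ∘ₗ mulTRat p D.X) = LinearMap.ker (mulTRat p D.X) := by
  obtain ⟨htors, g, hg, hLg⟩ :=
    cm_isTorsion_and_exists_charGenerator_order_eq hBCS W p h5 hgood hord hCM hκ hγ hγ' D f hf
  haveI : Module.Finite (IwasawaAlgebra p) D.X := D.module_finite_of_isCyclotomic W κ hκ hγ
  rw [hLg, ← (Greenberg1999_coinvariantsRank_eq_selmerCorank_rat_holds W p hgood hord κ γ hκ hγ D).2]
  exact IwasawaAlgebra.order_charGenerator_eq_coinvariantsRank_iff p htors g hg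

/-- **The stub's inequality at `(E, p)` ↔ `T`-semisimplicity, for a CM curve** (same hypotheses as
`cm_order_eq_selmerCorank_iff_semisimple`): `ord_{T=0} L_p ≤ corank_{ℤ_p} Sel_{p^∞}(E/ℚ) ↔
ker (T ⊗ 1)² = ker (T ⊗ 1)` on `ℚ_p ⊗_{ℤ_p} X`, because the reverse inequality
`corank ≤ ord_T g = ord_T L_p` holds unconditionally (control + structure theorem,
`selmerCorank_le_order_charGenerator`). This is the precise sense in which stub
`stub_orderLeCorankCM` of line `rubin-squeeze` IS Greenberg's Conj. 1.12 at `T` for CM curves.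
[cite: GreenbergLNM1716, §1 Conj. 1.12 and p. 65] -/
theorem cm_order_le_selmerCorank_iff_semisimple
    (hBCS : burungale_castella_skinner_charIdeal_eq_padicLFunction)
    (W : WeierstrassCurve ℚ) [W.IsElliptic] [W.IsGloballyMinimal] (p : ℕ) [Fact p.Prime]
    (h5 : 5 ≤ p) (hgood : W.HasGoodReductionAtPrime p) (hord : ¬ (p : ℤ) ∣ W.frobeniusTrace p)
    (hCM : W.HasCM) {κ : ZpExtension ℚ p} {γ : Field.absoluteGaloisGroup ℚ}
    (hκ : κ.IsCyclotomic) (hγ : κ.IsTopGenerator γ) (hγ' : IsCyclotomicVariable p γ)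
    (D : W.SelmerDualData κ γ) {N : ℕ} [NeZero N] (f : CuspForm (CongruenceSubgroup.Gamma0 N) 2)
    (hf : IsNewformOf W f) :
    (padicLFunction f (unitRoot W p : ℚ_[p])).order ≤ (W.selmerCorank p : ℕ∞) ↔
      LinearMap.ker (mulTRat p D.X ∘ₗ mulTRat p D.X) = LinearMap.ker (mulTRat p D.X) := by
  rw [← cm_order_eq_selmerCorank_iff_semisimple hBCS W p h5 hgood hord hCM hκ hγ hγ' D f hf]
  obtain ⟨htors, g, hg, hLg⟩ :=
    cm_isTorsion_and_exists_charGenerator_order_eq hBCS W p h5 hgood hord hCM hκ hγ hγ' D f hf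
  haveI : Module.Finite (IwasawaAlgebra p) D.X := D.module_finite_of_isCyclotomic W κ hκ hγ
  have hle : (W.selmerCorank p : ℕ∞) ≤ (padicLFunction f (unitRoot W p : ℚ_[p])).order := by
    rw [hLg]
    exact selmerCorank_le_order_charGenerator Greenberg1999_coinvariantsRank_eq_selmerCorank_rat_holds
      W p hgood hord hκ hγ D htors hg
  exact ⟨fun h => le_antisymm h hle, fun h => h.le⟩

end Pointwise

/-! ### Globally: the stub statement versus Conj. 1.12 for CM curves, and the stub from the items -/

/-- **The stub from the printed main conjecture and `T`-semisimplicity for CM curves of analytic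
rank `≥ 3`.** Hypotheses: the named fact `burungale_castella_skinner_charIdeal_eq_padicLFunction`
and `hSS`: for every CM curve `E/ℚ` (globally minimal `W`) with `ord_{s=1} L(E,s) ≥ 3`, every good
ordinary `p ≥ 5`, the cyclotomic `κ, γ` matching the variable and every dual datum `D`,
`ker (T ⊗ 1)² = ker (T ⊗ 1)` on `ℚ_p ⊗_{ℤ_p} X` (OPEN from corank `2`; spelled out verbatim).
Conclusion: the registered statement of `stub_orderLeCorankCM`, verbatim. Proof: a cyclotomic datum
matching the variable exists (`exists_isCyclotomic_isTopGenerator_isCyclotomicVariable_holds`), a dual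
datum exists (`WeierstrassCurve.nonempty_selmerDualData_holds`), then
`cm_order_le_selmerCorank_iff_semisimple`. [cite: GreenbergLNM1716, §1 Conj. 1.12 and p. 65] -/
theorem orderLeCorankCM_of_bcs_of_semisimpleCM
    (hBCS : burungale_castella_skinner_charIdeal_eq_padicLFunction)
    (hSS : ∀ (W : WeierstrassCurve ℚ) [W.IsElliptic] [W.IsGloballyMinimal] (p : ℕ) [Fact p.Prime],
      5 ≤ p → W.HasGoodReductionAtPrime p → ¬ (p : ℤ) ∣ W.frobeniusTrace p → W.HasCM →
      3 ≤ W.analyticRank →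
      ∀ (κ : ZpExtension ℚ p) (γ : Field.absoluteGaloisGroup ℚ), κ.IsCyclotomic →
        κ.IsTopGenerator γ → IsCyclotomicVariable p γ → ∀ (D : W.SelmerDualData κ γ),
        LinearMap.ker (mulTRat p D.X ∘ₗ mulTRat p D.X) = LinearMap.ker (mulTRat p D.X)) :
    ∀ (W : WeierstrassCurve ℚ) [W.IsElliptic] [W.IsGloballyMinimal] (p : ℕ) [Fact p.Prime],
      5 ≤ p → W.HasGoodReductionAtPrime p → ¬ (p : ℤ) ∣ W.frobeniusTrace p → W.HasCM →
      3 ≤ W.analyticRank →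
      ∀ {N : ℕ} [NeZero N] (f : CuspForm (CongruenceSubgroup.Gamma0 N) 2), IsNewformOf W f →
        (padicLFunction f (unitRoot W p : ℚ_[p])).order ≤ (W.selmerCorank p : ℕ∞) := by
  intro W _ _ p _ h5 hgood hord hCM h3 N _ f hf
  obtain ⟨κ, hκ, γ, hγ, hγ'⟩ := exists_isCyclotomic_isTopGenerator_isCyclotomicVariable_holds p
  obtain ⟨D⟩ := W.nonempty_selmerDualData_holds κ γ hγ
  exact (cm_order_le_selmerCorank_iff_semisimple hBCS W p h5 hgood hord hCM hκ hγ hγ' D f hf).mpr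
    (hSS W p h5 hgood hord hCM h3 κ γ hκ hγ hγ' D)

/-- **The stub IS Conj. 1.12 at `T` for CM curves of analytic rank `≥ 3`, modulo print.** Under the
named facts `burungale_castella_skinner_charIdeal_eq_padicLFunction` (main conjecture; Rubin for CM)
and `exists_isNewformOf` (modularity; for CM curves Deuring–Hecke–Shimura), the registered statement
of `stub_orderLeCorankCM` (left) is EQUIVALENT to: for every CM curve `E/ℚ` (globally minimal `W`)
with `ord_{s=1} L(E,s) ≥ 3`, every good ordinary `p ≥ 5`, the cyclotomic `κ, γ` matching the
variable and every dual datum `D`, `ker (T ⊗ 1)² = ker (T ⊗ 1)` on `ℚ_p ⊗_{ℤ_p} X(E/ℚ_∞)` (right).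
`→`: read the stub at the newform of `E` (conductor `≥ 1`, `conductorNorm_pos_holds`) and apply
`cm_order_le_selmerCorank_iff_semisimple`; `←`: `orderLeCorankCM_of_bcs_of_semisimpleCM`.
[cite: GreenbergLNM1716, §1 Conj. 1.12 and p. 65] [cite: DiamondShurman2005, Thm. 8.8.3] -/
theorem orderLeCorankCM_iff_semisimpleCM
    (hBCS : burungale_castella_skinner_charIdeal_eq_padicLFunction) (hmod : exists_isNewformOf) :
    (∀ (W : WeierstrassCurve ℚ) [W.IsElliptic] [W.IsGloballyMinimal] (p : ℕ) [Fact p.Prime],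
      5 ≤ p → W.HasGoodReductionAtPrime p → ¬ (p : ℤ) ∣ W.frobeniusTrace p → W.HasCM →
      3 ≤ W.analyticRank →
      ∀ {N : ℕ} [NeZero N] (f : CuspForm (CongruenceSubgroup.Gamma0 N) 2), IsNewformOf W f →
        (padicLFunction f (unitRoot W p : ℚ_[p])).order ≤ (W.selmerCorank p : ℕ∞)) ↔
    (∀ (W : WeierstrassCurve ℚ) [W.IsElliptic] [W.IsGloballyMinimal] (p : ℕ) [Fact p.Prime],
      5 ≤ p → W.HasGoodReductionAtPrime p → ¬ (p : ℤ) ∣ W.frobeniusTrace p → W.HasCM →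
      3 ≤ W.analyticRank →
      ∀ (κ : ZpExtension ℚ p) (γ : Field.absoluteGaloisGroup ℚ), κ.IsCyclotomic →
        κ.IsTopGenerator γ → IsCyclotomicVariable p γ → ∀ (D : W.SelmerDualData κ γ),
        LinearMap.ker (mulTRat p D.X ∘ₗ mulTRat p D.X) = LinearMap.ker (mulTRat p D.X)) := by
  refine ⟨fun h => ?_, orderLeCorankCM_of_bcs_of_semisimpleCM hBCS⟩
  intro W _ _ p _ h5 hgood hord hCM h3 κ γ hκ hγ hγ' D
  haveI : NeZero (W.conductorNorm ℤ) := ⟨(WeierstrassCurve.conductorNorm_pos_holds W).ne'⟩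
  obtain ⟨f, hf⟩ := hmod W
  exact (cm_order_le_selmerCorank_iff_semisimple hBCS W p h5 hgood hord hCM hκ hγ hγ' D f hf).mp
    (h W p h5 hgood hord hCM h3 f hf)

/-- **The stub from the printed main conjecture and the route item `PAdicOrderSemisimpleR3`
(stmt-BirchSwinnertonDyer-0509) by name** (Greenberg's Conj. 1.12 at `T`, integral spelling
`p^k T² x = 0 ⇒ p^{k'} T x = 0`, at every odd good ordinary prime and every curve; only its CM /
`p ≥ 5` / `r_an ≥ 3` column is used, through the landed SS-bridge `stub_ker_mulTRat_sq_eq`).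
[cite: GreenbergLNM1716, §1 Conj. 1.12 and p. 65] -/
theorem orderLeCorankCM_of_bcs_of_semisimple
    (hBCS : burungale_castella_skinner_charIdeal_eq_padicLFunction) (hSS : PAdicOrderSemisimpleR3) :
    ∀ (W : WeierstrassCurve ℚ) [W.IsElliptic] [W.IsGloballyMinimal] (p : ℕ) [Fact p.Prime],
      5 ≤ p → W.HasGoodReductionAtPrime p → ¬ (p : ℤ) ∣ W.frobeniusTrace p → W.HasCM →
      3 ≤ W.analyticRank →
      ∀ {N : ℕ} [NeZero N] (f : CuspForm (CongruenceSubgroup.Gamma0 N) 2), IsNewformOf W f →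
        (padicLFunction f (unitRoot W p : ℚ_[p])).order ≤ (W.selmerCorank p : ℕ∞) := by
  refine orderLeCorankCM_of_bcs_of_semisimpleCM hBCS ?_
  intro W _ _ p _ h5 hgood hord _ _ κ γ hκ hγ _ D
  exact stub_ker_mulTRat_sq_eq p D.X (hSS W p (by omega) hgood hord κ γ hκ hγ D)

/-- **The stub from route `PAdicOrderV2`'s items `PAdicOrderMainConjectureR7` (stmt-15426) and
`PAdicOrderSemisimpleR3` (stmt-0509) by name** — the CM / `p ≥ 5` / `r_an ≥ 3` column of the landed
`stub_padicBSDrank_orderEqCorankOdd` (MC ∧ SS ∧ control ⇒ `ord_T L_p = corank` at every odd good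
ordinary prime), whose control hypothesis is the tree theorem
`Greenberg1999_coinvariantsRank_eq_selmerCorank_rat_holds` (Mazur 1972 §6; Greenberg LNM 1716 Thm. 1.2).
(Registered sub-goal of stmt-BirchSwinnertonDyer-18086; the route items are spelled fully qualified.)
[cite: GreenbergLNM1716, §1 Conj. 1.12 and p. 65, Thm. 1.2] -/
theorem orderLeCorankCM_of_mainConjecture_of_semisimple :
    Summit.BirchSwinnertonDyer.BirchSwinnertonDyer.Theses.PAdicOrderV2.PAdicOrderMainConjectureR7 →
    Summit.BirchSwinnertonDyer.BirchSwinnertonDyer.Theses.PAdicOrderV2.PAdicOrderSemisimpleR3 →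
    ∀ (W : WeierstrassCurve ℚ) [W.IsElliptic] [W.IsGloballyMinimal] (p : ℕ) [Fact p.Prime],
      5 ≤ p → W.HasGoodReductionAtPrime p → ¬ (p : ℤ) ∣ W.frobeniusTrace p → W.HasCM →
      3 ≤ W.analyticRank →
      ∀ {N : ℕ} [NeZero N] (f : CuspForm (CongruenceSubgroup.Gamma0 N) 2), IsNewformOf W f →
        (padicLFunction f (unitRoot W p : ℚ_[p])).order ≤ (W.selmerCorank p : ℕ∞) := by
  intro hMC hSS W _ _ p _ h5 hgood hord _ _ N _ f hf
  exact (stub_padicBSDrank_orderEqCorankOdd hMC hSS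
    Greenberg1999_coinvariantsRank_eq_selmerCorank_rat_holds W p (by omega) ⟨hgood, hord⟩ f hf).le

end Summit.BirchSwinnertonDyer.BirchSwinnertonDyer.Theorems
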